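/-
Copyright (c) 2026 the pub-hodgecm-mathlib formalisation cell (harness21).  Prover seat hodgecm-mathlib-K2E1-p08 (g4), Track B ∕ K2-LIT, h413 =
`stmt-HodgeConjecture-24833`, line `K2_E1_TraceFormulaBeta`, campaign «EIS-RANK-ONE» rung R2 «Godement»; DEAL «EIS-U3-GODEMENT» of the dealer K2E1-plan (g3)
2026-09-04T04:19:39Z ∕ ruling R-EIS-1 ∕ «=» 04:38:21Z, file (G): the Borel Eisenstein series of `U(J_N)` converges absolutely GIVEN the Siegel-domain integral E4.
-/
import Summits.HodgeConjecture.HodgeConjecture.Theorems.K2E1BorelEisensteinUDefs      -- ★ p857359 (this seat): `eisensteinSeriesU`, `flatSectionU`, the coset type, ★ height API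
import Summits.HodgeConjecture.HodgeConjecture.Theorems.K2E1GodementCount            -- ★ p857387 (this seat): Godement's count, generic (E2, E3a, multiplicity, engine)
import Literature.NumberTheory.Automorphic.UnitaryGroupIwasawaAdelic                 -- ★ CM Iwasawa `exists_mem_borelAdelic_mul_mem_standardMaximalCompactGL_cm`
import Literature.NumberTheory.Automorphic.UnitaryGroupIwasawaIntegration            -- ★ `isCompact_comap_adelicVal_standardMaximalCompactGL` (`K_U` compact)
import Literature.NumberTheory.Automorphic.AdelicVectorHeightCompact                 -- ★ `vecHeight_vecMul_of_mem_standardMaximalCompactGL` (`K_U` preserves heights)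
import Literature.NumberTheory.Automorphic.UnitaryGroupBorelHeightBigCellTwo         -- ★ big cell `H(γ g)·H(g) ≤ 1` off `B`, `N = 3` and `N = 2`
import Literature.NumberTheory.Automorphic.UnitaryGroupTorusSiegelIntegral           -- ★ `borelHeight_pos`
import Literature.NumberTheory.Automorphic.UnitaryGroupKernelFiniteSum               -- ★ `isDiscreteRational_quasiSplit` (`G(F)` discrete in `G(𝔸)`, every `(F, E, c, N)`)
import HarnessLib

/-!
# K2·E1 — `K2E1BorelEisensteinGodementU`: GODEMENT'S CRITERION FOR THE BOREL EISENSTEIN SERIES OF `U(J_N)` — `Σ_{γ ∈ B(F)∖G(F)} H(γ g)^τ < ∞` GIVEN THE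
# SIEGEL-DOMAIN INTEGRAL «E4», with the locally uniform majorant (campaign EIS-RANK-ONE, rung R2)

Track B ∕ K2-LIT, crux h413 = `stmt-HodgeConjecture-24833`, route of record `HCCMUnconditional`; cell `hodgecm-mathlib`, squad K2, ENGINE E1.  Prover seat
`hodgecm-mathlib-K2E1-p08` (g4); DEAL «EIS-U3-GODEMENT» (K2E1-plan (g3) 04:19:39Z; ruling R-EIS-1 04:25:41Z; split «=» 04:38:21Z with the `N`-generic ask), file (G).
THEOREMS ONLY (no `def`, no `instance`, no notation, no named-fact hypothesis, no `sorry`); lane `--kind proof --supports stmt-HodgeConjecture-24833 --as helper` (count-neutral).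

SETTING.  Mok's `G = U(J_N)` (`quasiSplit F E c N`), `G(𝔸) = G(𝔸_F)`, `H = ` ★ `borelHeight`, the rational Borel `B(F) = borelU c J_N ≤ G(F) = unitaryGroupOfForm c J_N` and its
cosets `B(F)∖G(F) = Quotient (orbitRel ↥B(F) ↥G(F))` (★ p857160, ruling R-EIS-1), representatives `γ̃_q = toAdelic (q.out : ↥G(F))` (★ p857359 `eisensteinSeriesU`).  In
`G(𝔸)`: `Γ = G(F)` (`arithmeticSubgroup`, discrete: ★ `isDiscreteRational_quasiSplit`) and `Γ' = B(𝔸) ⊓ G(F)`.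

* §1 **SMEAR** (any `N`, under an Iwasawa decomposition `G(𝔸) = B(𝔸)·K_U` as hypothesis — ★ `exists_mem_borelAdelic_mul_mem_standardMaximalCompactGL_cm` for CM pairs):
  `exists_smear_borelHeight` — for `C` compact, `∃ A ≥ 1, ∀ x, ∀ c ∈ C, H(x c) ≤ A·H(x) ∧ H(x) ≤ A·H(x c)` (`x = b k`, `H(b y) = χ(b) H(y)` ★, `H(y k) = H(y)` on `K_U` ★,
  `H` continuous and positive on the compact `K_U · C`) [Garrett2018 §3.10 «`h(v) ≪_C h(v·g) ≪_C h(v)`»].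
* §2 **CEILING** (`N = 3`, `N = 2`, ★ big cell): `borelHeight_toAdelic_mul_le_max_three ∕ _two` — `H(γ̃ g) ≤ max (H g) (H g)⁻¹` for every `γ ∈ G(F)`.
* §3 **THE SECTION**: `existsUnique_borelQuotient` — `∀ γ ∈ Γ, ∃! q, γ · γ̃_q⁻¹ ∈ Γ'` (no injectivity needed: membership of `toAdelic x` in `B(𝔸)` is read on the matrix of `x`,
  ★ `toAdelic_mem_borelAdelic_iff`); `borelHeight_mul_of_mem_inf` (`H(γ' y) = H(y)` on `Γ'`); `countable_borelQuotient`.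
* §4 **THE HEAD (any `N`, hypothesis-first)** `summable_borelHeight_rpow_of_siegelIntegral`: Iwasawa + a height ceiling along `G(F)g` + **E4 :=
  «∃ a `Γ'`-covering weight `β'` on `G(𝔸)` with `∫⁻ 𝟙_{H ≤ C₀} H^τ β' dμ ≠ ∞ for every C₀`** (`μ` a Haar measure on `G(𝔸)`, `τ ≥ 0`) ⟹ `∀ g, Summable (q ↦ H(γ̃_q g)^τ)` — by ★
  p857387's engine `summable_toReal_of_lintegral_weight_ne_top` with `ψ₂ = 𝟙_{H ≤ A C₀} H^τ`, `ψ₁ = 𝟙_{H ≤ C₀} H^τ`, the smear of §1, the multiplicity of a compact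
  neighbourhood (★ `exists_nat_forall_coveringSum_indicator_le`) and a `Γ`-weight (★ `exists_isCoveringWeight`); **`summable_borelHeight_rpow_mul_of_siegelIntegral`** — the
  same series is summable LOCALLY UNIFORMLY: `∀ g₀, ∃ U ∈ 𝓝 g₀, ∀ g ∈ U, ∀ q, H(γ̃_q g)^τ ≤ A^τ H(γ̃_q g₀)^τ` (reverse smear).
* §5 **THE R-EIS-1 HEADS**: `summable_norm_flatSectionU_of_siegelIntegral` (`φ` bounded ⟹ `∀ g, Summable (q ↦ ‖flatSectionU φ z (γ̃_q g)‖)`, `τ = z.re ≥ 0`) and the R4a MAJORANT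
  SHAPE verbatim `exists_locallyUniform_majorant_flatSectionU` (`∀ g₀, ∃ U ∈ 𝓝 g₀, ∃ u, Summable u ∧ ∀ g ∈ U, ∀ q, ‖flatSectionU φ z (γ̃_q * g)‖ ≤ u q`); the instances
  `…_three ∕ …_two` (ceiling discharged by ★ big cell) and `…_cm_three` (Iwasawa discharged at the CM pair: the input of 5Res ∕ 12R3 is `cmDatum L 3 J₃`) — in the sequel file (G′) `K2E1BorelEisensteinGodementU3`.
WHAT IS LEFT AS HYPOTHESIS: E4 (file (G2) `K2E1BorelParabolicReductionU3` turns Godement's parabolic integral E5 into E4; file (G3) proves E5 for `τ > 2` at `N = 3`).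
HONEST LABEL: HC_CM is proved only modulo the 7 printed citations (2 remaining named inputs: hLiu418 = `stmt-HodgeConjecture-24832`, h413 = `stmt-HodgeConjecture-24833`) until rung 0
closes; count-neutral helper, proves no printed statement, closes no socket.
References: [Godement1964] R. Godement, Sém. Bourbaki 257, §8 · [Garrett2018] P. Garrett, *Modern Analysis of Automorphic Forms by Example* (2018), §2.8, §3.10 (proof of Cor. 3.10.2) ·
[MoeglinWaldspurger1995] C. Mœglin, J.-L. Waldspurger, *Spectral Decomposition and Eisenstein Series* (1995), II.1.5 Prop. · [Rogawski1990] J. D. Rogawski, *Automorphic Representations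
of Unitary Groups in Three Variables* (1990), §2.2.
-/

set_option autoImplicit false
-- the mandated namespace repeats the single-problem summit's segment (`HodgeConjecture.HodgeConjecture`)
set_option linter.dupNamespace false

noncomputable section

open MeasureTheory MeasureTheory.Measure Set Filter Topology MulAction NumberField IsDedekindDomain
open scoped ENNReal NNReal Pointwise MatrixGroups
open Literature.MeasureTheory.Group
open Literature.NumberTheory.Automorphic Literature.NumberTheory.Automorphic.UnitaryGroup
open Summit.HodgeConjecture.HodgeConjecture.Cruxes.H413.K2E1BorelEisensteinU
open Summit.HodgeConjecture.HodgeConjecture.Cruxes.H413.K2E1GodementCount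

namespace Summit.HodgeConjecture.HodgeConjecture.Cruxes.H413.K2E1BorelEisensteinGodementU

variable {F E : Type} [Field F] [NumberField F] [Field E] [NumberField E] [Algebra F E] {c : E ≃ₐ[F] E} {N : ℕ}

/-! ## §1 Smear: `H(x c) ≍ H(x)` uniformly in `x ∈ G(𝔸)`, `c` in a compact set -/

section Smear

variable [NeZero N]

/-- `K_U` preserves the height: `H(y k) = H(y)` for `adelicVal k ∈ K_∞ · GL_N(𝒪̂_E)` (★ `vecHeight_vecMul_of_mem_standardMaximalCompactGL`). [cite: Garrett2018, §2.2] -/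
theorem borelHeight_mul_of_adelicVal_mem {k : (quasiSplit F E c N).Adelic}
    (hk : adelicVal F E c N ((StdForm.antidiagonal N).over E) k ∈ standardMaximalCompactGL N E) (y : (quasiSplit F E c N).Adelic) :
    borelHeight (y * k) = borelHeight y :=
  borelHeight_mul_of_forall_vecHeight_vecMul_eq (fun x => vecHeight_vecMul_of_mem_standardMaximalCompactGL hk x) y

/-- **SMEAR.**  Under an Iwasawa decomposition `G(𝔸) = B(𝔸)·K_U` (hypothesis `hIw`; ★ for CM pairs), for every compact `C ⊆ G(𝔸)` there is `A ≥ 1` with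
`H(x c) ≤ A·H(x)` and `H(x) ≤ A·H(x c)` for ALL `x ∈ G(𝔸)`, `c ∈ C`: writing `x = b k`, `H(x c) ∕ H(x) = H(k c) ∕ H(1)` with `k c` in the compact `K_U · C`, on which the continuous
positive `H` is pinched. [cite: Garrett2018, §3.10 (proof of Cor. 3.10.2)] [cite: MoeglinWaldspurger1995, I.2.2] -/
theorem exists_smear_borelHeight
    (hIw : ∀ g : (quasiSplit F E c N).Adelic, ∃ b ∈ borelAdelic F E c N, ∃ k : (quasiSplit F E c N).Adelic,
      adelicVal F E c N ((StdForm.antidiagonal N).over E) k ∈ standardMaximalCompactGL N E ∧ g = b * k)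
    {C : Set (quasiSplit F E c N).Adelic} (hC : IsCompact C) :
    ∃ A : ℝ≥0, 1 ≤ A ∧ ∀ x : (quasiSplit F E c N).Adelic, ∀ c' ∈ C,
      borelHeight (x * c') ≤ A * borelHeight x ∧ borelHeight x ≤ A * borelHeight (x * c') := by
  rcases C.eq_empty_or_nonempty with hCe | ⟨c₀, hc₀⟩
  · exact ⟨1, le_rfl, fun x c' hc' => (hCe ▸ hc' : c' ∈ (∅ : Set _)).elim⟩
  set K : Set (quasiSplit F E c N).Adelic := (((standardMaximalCompactGL N E).comap (adelicVal F E c N ((StdForm.antidiagonal N).over E)) :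
    Subgroup (quasiSplit F E c N).Adelic) : Set (quasiSplit F E c N).Adelic) with hK
  have hKc : IsCompact K := isCompact_comap_adelicVal_standardMaximalCompactGL
  have hKC : IsCompact (K * C) := hKc.mul hC
  have h1K : (1 : (quasiSplit F E c N).Adelic) ∈ K := by rw [hK]; exact Subgroup.one_mem _
  have hne : (K * C).Nonempty := ⟨1 * c₀, Set.mul_mem_mul h1K hc₀⟩
  obtain ⟨xm, hxm, hmin⟩ := hKC.exists_isMinOn hne continuous_borelHeight.continuousOn
  obtain ⟨xM, hxM, hmax⟩ := hKC.exists_isMaxOn hne continuous_borelHeight.continuousOn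
  have hm0 : 0 < borelHeight xm := borelHeight_pos xm
  have h10 : 0 < borelHeight (1 : (quasiSplit F E c N).Adelic) := borelHeight_pos 1
  refine ⟨max 1 (max (borelHeight xM / borelHeight (1 : (quasiSplit F E c N).Adelic)) (borelHeight (1 : (quasiSplit F E c N).Adelic) / borelHeight xm)),
    le_max_left _ _, fun x c' hc' => ?_⟩
  obtain ⟨b, hb, k, hk, rfl⟩ := hIw x
  have hkc : k * c' ∈ K * C := Set.mul_mem_mul (by rw [hK]; exact Subgroup.mem_comap.2 hk) hc'
  have hlo : borelHeight xm ≤ borelHeight (k * c') := hmin hkc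
  have hhi : borelHeight (k * c') ≤ borelHeight xM := hmax hkc
  have hk1 : borelHeight k = borelHeight (1 : (quasiSplit F E c N).Adelic) := by
    rw [← one_mul k, borelHeight_mul_of_adelicVal_mem hk]
  rw [mul_assoc, borelHeight_borel_mul hb (k * c'), borelHeight_borel_mul hb k, hk1]
  constructor
  · -- `χ⁻¹ H(k c) ≤ A χ⁻¹ H(1)`
    rw [mul_left_comm]
    refine mul_le_mul_right ?_ _
    calc borelHeight (k * c') ≤ borelHeight xM := hhi
      _ = borelHeight xM / borelHeight (1 : (quasiSplit F E c N).Adelic) * borelHeight (1 : (quasiSplit F E c N).Adelic) := (div_mul_cancel₀ _ h10.ne').symm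
      _ ≤ _ := mul_le_mul_left ((le_max_left _ _).trans (le_max_right _ _)) _
  · rw [mul_left_comm]
    refine mul_le_mul_right ?_ _
    calc borelHeight (1 : (quasiSplit F E c N).Adelic) = borelHeight (1 : (quasiSplit F E c N).Adelic) / borelHeight xm * borelHeight xm := (div_mul_cancel₀ _ hm0.ne').symm
      _ ≤ borelHeight (1 : (quasiSplit F E c N).Adelic) / borelHeight xm * borelHeight (k * c') := mul_le_mul_right hlo _
      _ ≤ _ := mul_le_mul_left ((le_max_right _ _).trans (le_max_right _ _)) _

end Smear

/-! ## §2 Ceiling: `H(γ̃ g) ≤ max (H g) (H g)⁻¹` along the orbit `G(F) g` (`N = 3`, `N = 2`) -/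

/-- **CEILING, `N = 3`**: `H(γ̃ g) ≤ max (H g) (H g)⁻¹` for every `γ ∈ U(J₃)(F)` — `= H(g)` on `B(F)` (★ `borelHeight_rational_borel_mul`), `≤ H(g)⁻¹` off it (★ big cell
`borelHeight_mul_borelHeight_le_one_of_not_mem_borelAdelic`). [cite: Garrett2018, §2.3] [cite: Rogawski1990, §2.2] -/
theorem borelHeight_toAdelic_mul_le_max_three (γ : (quasiSplit F E c 3).Rational) (g : (quasiSplit F E c 3).Adelic) :
    borelHeight ((quasiSplit F E c 3).toAdelic γ * g) ≤ max (borelHeight g) (borelHeight g)⁻¹ := by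
  by_cases hγ : (quasiSplit F E c 3).toAdelic γ ∈ borelAdelic F E c 3
  · rw [borelHeight_rational_borel_mul γ hγ g]
    exact le_max_left _ _
  · refine le_trans ?_ (le_max_right _ _)
    rw [NNReal.le_inv_iff_mul_le (borelHeight_pos g).ne']
    exact borelHeight_mul_borelHeight_le_one_of_not_mem_borelAdelic hγ g

/-- **CEILING, `N = 2`** (★ `borelHeight_mul_borelHeight_le_one_of_not_mem_borelAdelic_two`). [cite: Garrett2018, §2.3] -/
theorem borelHeight_toAdelic_mul_le_max_two (γ : (quasiSplit F E c 2).Rational) (g : (quasiSplit F E c 2).Adelic) :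
    borelHeight ((quasiSplit F E c 2).toAdelic γ * g) ≤ max (borelHeight g) (borelHeight g)⁻¹ := by
  by_cases hγ : (quasiSplit F E c 2).toAdelic γ ∈ borelAdelic F E c 2
  · rw [borelHeight_rational_borel_mul γ hγ g]
    exact le_max_left _ _
  · refine le_trans ?_ (le_max_right _ _)
    rw [NNReal.le_inv_iff_mul_le (borelHeight_pos g).ne']
    exact borelHeight_mul_borelHeight_le_one_of_not_mem_borelAdelic_two hγ g

/-! ## §3 The section `q ↦ γ̃_q` of `Γ'∖Γ` inside `G(𝔸)`, `Γ' = B(𝔸) ⊓ G(F)` -/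

section TheSection

/-- `toAdelic (x δ⁻¹) ∈ B(𝔸) ⊓ G(F)` iff `x δ⁻¹ ∈ B(F)` iff `[x] = [δ]` in `B(F)∖G(F)` — membership in `B(𝔸)` is read on the rational matrix (★ `toAdelic_mem_borelAdelic_iff`),
and ★ p857160 `mk_eq_mk_iff`. [cite: Rogawski1990, §2.2] -/
theorem toAdelic_mul_inv_mem_inf_iff (x δ : ↥(unitaryGroupOfForm (c : E →+* E) ((StdForm.antidiagonal N).over E))) :
    (quasiSplit F E c N).toAdelic x * ((quasiSplit F E c N).toAdelic δ)⁻¹ ∈ borelAdelic F E c N ⊓ (quasiSplit F E c N).arithmeticSubgroup ↔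
      Quotient.mk (orbitRel ↥(borelU (c : E →+* E) ((StdForm.antidiagonal N).over E)) ↥(unitaryGroupOfForm (c : E →+* E) ((StdForm.antidiagonal N).over E))) x =
        Quotient.mk _ δ := by
  have hprod : (quasiSplit F E c N).toAdelic x * ((quasiSplit F E c N).toAdelic δ)⁻¹ = (quasiSplit F E c N).toAdelic (x * δ⁻¹) := by
    have hm : (quasiSplit F E c N).toAdelic (x * δ⁻¹) = (quasiSplit F E c N).toAdelic x * (quasiSplit F E c N).toAdelic δ⁻¹ := map_mul _ _ _
    have hi : (quasiSplit F E c N).toAdelic δ⁻¹ = ((quasiSplit F E c N).toAdelic δ)⁻¹ := map_inv _ _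
    rw [hm, hi]
  rw [hprod, K2E1BruhatCosetsU.mk_eq_mk_iff]
  constructor
  · intro h
    exact ⟨⟨x * δ⁻¹, (mem_borelU_iff _).2 ((toAdelic_mem_borelAdelic_iff (F := F) (c := c) (x * δ⁻¹)).1 h.1)⟩, inv_mul_cancel_right x δ⟩
  · rintro ⟨b, hb⟩
    have hbx : x * δ⁻¹ = b := by rw [← hb, mul_inv_cancel_right]
    rw [hbx]
    exact ⟨toAdelic_mem_borelAdelic_of_mem_borelU b.2, ⟨_, rfl⟩⟩

/-- **THE SECTION**: every `γ ∈ Γ = G(F)` has exactly one coset representative `γ̃_q` with `γ γ̃_q⁻¹ ∈ Γ' = B(𝔸) ⊓ G(F)` — the `∃!` hypothesis of ★ p857387's engine and of ★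
`lintegral_mul_eq_lintegral_tsum_mul`. [cite: Garrett2018, §3.10] -/
theorem existsUnique_borelQuotient {γ : (quasiSplit F E c N).Adelic} (hγ : γ ∈ (quasiSplit F E c N).arithmeticSubgroup) :
    ∃! q : Quotient (orbitRel ↥(borelU (c : E →+* E) ((StdForm.antidiagonal N).over E)) ↥(unitaryGroupOfForm (c : E →+* E) ((StdForm.antidiagonal N).over E))),
      γ * ((quasiSplit F E c N).toAdelic (Quotient.out q : ↥(unitaryGroupOfForm (c : E →+* E) ((StdForm.antidiagonal N).over E))))⁻¹ ∈
        borelAdelic F E c N ⊓ (quasiSplit F E c N).arithmeticSubgroup := by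
  obtain ⟨γ₀, rfl⟩ := hγ
  refine ⟨Quotient.mk _ γ₀, ?_, fun q hq => ?_⟩
  · exact (toAdelic_mul_inv_mem_inf_iff (F := F) γ₀ _).2 (Quotient.out_eq _).symm
  · have h := (toAdelic_mul_inv_mem_inf_iff (F := F) γ₀ _).1 hq
    rw [Quotient.out_eq] at h
    exact h.symm

/-- `γ̃_q ∈ Γ`. [folklore] -/
theorem toAdelic_out_mem_arithmeticSubgroup
    (q : Quotient (orbitRel ↥(borelU (c : E →+* E) ((StdForm.antidiagonal N).over E)) ↥(unitaryGroupOfForm (c : E →+* E) ((StdForm.antidiagonal N).over E)))) :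
    (quasiSplit F E c N).toAdelic (Quotient.out q : ↥(unitaryGroupOfForm (c : E →+* E) ((StdForm.antidiagonal N).over E))) ∈ (quasiSplit F E c N).arithmeticSubgroup :=
  ⟨_, rfl⟩

variable [NeZero N] in
/-- `H(γ' y) = H(y)` for `γ' ∈ Γ' = B(𝔸) ⊓ G(F)` (★ `borelHeight_rational_borel_mul`). [cite: Garrett2018, §2.2] -/
theorem borelHeight_mul_of_mem_inf {γ : (quasiSplit F E c N).Adelic} (hγ : γ ∈ borelAdelic F E c N ⊓ (quasiSplit F E c N).arithmeticSubgroup)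
    (y : (quasiSplit F E c N).Adelic) : borelHeight (γ * y) = borelHeight y := by
  obtain ⟨hB, ⟨γ₀, hγ₀⟩⟩ := hγ
  rw [← hγ₀] at hB ⊢
  exact borelHeight_rational_borel_mul γ₀ hB y

omit [NumberField F] in
/-- `G(F) = U(J)(F) ≤ GL_N(E)` is countable (`E` a number field). [cite: Garrett2018, §1.8] -/
theorem countable_unitaryGroupOfForm (J : Matrix (Fin N) (Fin N) E) : Countable ↥(unitaryGroupOfForm (c : E →+* E) J) := by
  haveI : Countable E := NumberField.countable' (K := E)
  haveI : Countable (Matrix (Fin N) (Fin N) E) := inferInstanceAs (Countable (Fin N → Fin N → E))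
  haveI : Countable (GL (Fin N) E) := Units.val_injective.countable
  exact Subtype.countable

omit [NumberField F] in
/-- The coset space `B(F)∖G(F)` is countable. [cite: Garrett2018, §1.8] -/
theorem countable_borelQuotient :
    Countable (Quotient (orbitRel ↥(borelU (c : E →+* E) ((StdForm.antidiagonal N).over E)) ↥(unitaryGroupOfForm (c : E →+* E) ((StdForm.antidiagonal N).over E)))) := by
  haveI := countable_unitaryGroupOfForm (c := c) ((StdForm.antidiagonal N).over E)
  infer_instance

end TheSection

/-! ## §4 The head: `Σ_q H(γ̃_q g)^τ < ∞` given E4, locally uniformly -/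

section Head

variable [NeZero N] [MeasurableSpace (quasiSplit F E c N).Adelic] [BorelSpace (quasiSplit F E c N).Adelic]

/-- **GODEMENT'S CRITERION, HYPOTHESIS-FIRST (any `N`).**  Let `μ` be a Haar measure on `G(𝔸) = U(J_N)(𝔸_F)`, `G(𝔸) = B(𝔸)·K_U`
(Iwasawa, hypothesis `hIw`), and suppose the heights along each orbit `G(F)·g` are bounded (`hceil`, ★ big cell for `N ≤ 3`).  IF for some `Γ'`-covering weight `β'` on `G(𝔸)`
(`Γ' = B(𝔸) ⊓ G(F)`) every Siegel-domain integral `∫⁻ 𝟙_{H ≤ C₀} H^τ β' dμ` is finite («E4», `τ ≥ 0`), THEN `Σ_{q ∈ B(F)∖G(F)} H(γ̃_q g)^τ < ∞` for every `g` — smear (§1), count ≤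
integral + bounded multiplicity + unfolding (★ p857387 `summable_toReal_of_lintegral_weight_ne_top`). [cite: Godement1964, §8] [cite: Garrett2018, §3.10 (proof of Cor. 3.10.2)]
[cite: MoeglinWaldspurger1995, II.1.5] -/
theorem summable_borelHeight_rpow_of_siegelIntegral [T2Space (quasiSplit F E c N).Adelic] [SecondCountableTopology (quasiSplit F E c N).Adelic]
    [LocallyCompactSpace (quasiSplit F E c N).Adelic] (μ : Measure (quasiSplit F E c N).Adelic) [μ.IsHaarMeasure]
    (hIw : ∀ g : (quasiSplit F E c N).Adelic, ∃ b ∈ borelAdelic F E c N, ∃ k : (quasiSplit F E c N).Adelic,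
      adelicVal F E c N ((StdForm.antidiagonal N).over E) k ∈ standardMaximalCompactGL N E ∧ g = b * k)
    (hceil : ∀ g : (quasiSplit F E c N).Adelic, ∃ C₀ : ℝ≥0, ∀ γ : ↥(unitaryGroupOfForm (c : E →+* E) ((StdForm.antidiagonal N).over E)),
      borelHeight ((quasiSplit F E c N).toAdelic γ * g) ≤ C₀)
    {τ : ℝ} (hτ : 0 ≤ τ)
    (hE4 : ∃ β' : (quasiSplit F E c N).Adelic → ℝ≥0∞, IsCoveringWeight ↥(borelAdelic F E c N ⊓ (quasiSplit F E c N).arithmeticSubgroup) β' ∧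
      ∀ C₀ : ℝ≥0, ∫⁻ y, {y | borelHeight y ≤ C₀}.indicator (fun y => ENNReal.ofReal ((borelHeight y : ℝ) ^ τ)) y * β' y ∂μ ≠ ∞) :
    ∀ g : (quasiSplit F E c N).Adelic,
      Summable fun q : Quotient (orbitRel ↥(borelU (c : E →+* E) ((StdForm.antidiagonal N).over E)) ↥(unitaryGroupOfForm (c : E →+* E) ((StdForm.antidiagonal N).over E))) =>
        ((borelHeight ((quasiSplit F E c N).toAdelic (Quotient.out q : ↥(unitaryGroupOfForm (c : E →+* E) ((StdForm.antidiagonal N).over E))) * g) : ℝ)) ^ τ := by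
  intro g
  haveI : DiscreteTopology (quasiSplit F E c N).arithmeticSubgroup := isDiscreteRational_quasiSplit
  haveI : Countable (quasiSplit F E c N).arithmeticSubgroup := by
    haveI : Countable (quasiSplit F E c N).Rational := countable_unitaryGroupOfForm (c := c) ((StdForm.antidiagonal N).over E)
    exact (Set.countable_range (quasiSplit F E c N).toAdelic).to_subtype
  haveI := countable_borelQuotient (F := F) (E := E) (c := c) (N := N)
  obtain ⟨β', hβ', hI⟩ := hE4
  obtain ⟨β, hβ⟩ := exists_isCoveringWeight (quasiSplit F E c N).arithmeticSubgroup
  -- a compact neighbourhood `C` of `1`, its smear constant `A` and its multiplicity `m`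
  obtain ⟨C, hCc, hC1⟩ := exists_compact_mem_nhds (1 : (quasiSplit F E c N).Adelic)
  have hC0 : μ C ≠ 0 := (measure_pos_of_mem_nhds μ hC1).ne'
  have hCtop : μ C ≠ ∞ := hCc.measure_lt_top.ne
  obtain ⟨A, hA1, hA⟩ := exists_smear_borelHeight hIw hCc
  obtain ⟨m, hm⟩ := exists_nat_forall_coveringSum_indicator_le (quasiSplit F E c N).arithmeticSubgroup (hCc.smul g)
  obtain ⟨C₀, hC₀⟩ := hceil g
  -- the two truncated powers of the height
  set ψ₁ : (quasiSplit F E c N).Adelic → ℝ≥0∞ := {y | borelHeight y ≤ C₀}.indicator fun y => ENNReal.ofReal ((borelHeight y : ℝ) ^ τ) with hψ₁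
  set ψ₂ : (quasiSplit F E c N).Adelic → ℝ≥0∞ := {y | borelHeight y ≤ A * C₀}.indicator fun y => ENNReal.ofReal ((borelHeight y : ℝ) ^ τ) with hψ₂
  have hpow : Measurable fun y : (quasiSplit F E c N).Adelic => ENNReal.ofReal ((borelHeight y : ℝ) ^ τ) :=
    ENNReal.measurable_ofReal.comp ((measurable_borelHeight.coe_nnreal_real).pow_const τ)
  have hψ₂m : Measurable ψ₂ := hpow.indicator (isClosed_setOf_borelHeight_le _).measurableSet
  have hψ₂inv : ∀ γ ∈ borelAdelic F E c N ⊓ (quasiSplit F E c N).arithmeticSubgroup, ∀ y : (quasiSplit F E c N).Adelic, ψ₂ (γ * y) = ψ₂ y := fun γ hγ y => by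
    simp only [hψ₂, Set.indicator_apply, Set.mem_setOf_eq, borelHeight_mul_of_mem_inf hγ y]
  -- the smear `ψ₁(y) ≤ A^τ ψ₂(y c)`
  have hsm : ∀ y : (quasiSplit F E c N).Adelic, ∀ c' ∈ C, ψ₁ y ≤ ENNReal.ofReal ((A : ℝ) ^ τ) * ψ₂ (y * c') := by
    intro y c' hc'
    by_cases hy : borelHeight y ≤ C₀
    · have h1 : borelHeight (y * c') ≤ A * C₀ := (hA y c' hc').1.trans (mul_le_mul_right hy A)
      rw [hψ₁, hψ₂, indicator_of_mem (show y ∈ {y | borelHeight y ≤ C₀} from hy), indicator_of_mem (show y * c' ∈ {y | borelHeight y ≤ A * C₀} from h1),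
        ← ENNReal.ofReal_mul (Real.rpow_nonneg A.coe_nonneg τ), ← Real.mul_rpow A.coe_nonneg (borelHeight (y * c')).coe_nonneg]
      exact ENNReal.ofReal_le_ofReal (Real.rpow_le_rpow (borelHeight y).coe_nonneg (by exact_mod_cast (hA y c' hc').2) hτ)
    · rw [hψ₁, indicator_of_notMem (show y ∉ {y | borelHeight y ≤ C₀} from hy)]
      exact zero_le
  -- the engine
  have hmain := summable_toReal_of_lintegral_weight_ne_top μ (quasiSplit F E c N).arithmeticSubgroup
    (borelAdelic F E c N ⊓ (quasiSplit F E c N).arithmeticSubgroup) inf_le_right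
    (s := fun q : Quotient (orbitRel ↥(borelU (c : E →+* E) ((StdForm.antidiagonal N).over E)) ↥(unitaryGroupOfForm (c : E →+* E) ((StdForm.antidiagonal N).over E))) =>
      (quasiSplit F E c N).toAdelic (Quotient.out q : ↥(unitaryGroupOfForm (c : E →+* E) ((StdForm.antidiagonal N).over E))))
    toAdelic_out_mem_arithmeticSubgroup (fun γ hγ => existsUnique_borelQuotient hγ) (ψ₁ := ψ₁) (ψ₂ := ψ₂)
    (fun y => ne_top_of_le_ne_top ENNReal.ofReal_ne_top (indicator_le_self _ _ y)) hψ₂m hψ₂inv hCc.measurableSet hC0 hCtop ENNReal.ofReal_ne_top hsm hβ hβ' (hI (A * C₀)) g hm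
  refine hmain.1.congr fun q => ?_
  have hq : borelHeight ((quasiSplit F E c N).toAdelic (Quotient.out q : ↥(unitaryGroupOfForm (c : E →+* E) ((StdForm.antidiagonal N).over E))) * g) ≤ C₀ := hC₀ _
  simp only [hψ₁]
  rw [indicator_of_mem (show _ ∈ {y : (quasiSplit F E c N).Adelic | borelHeight y ≤ C₀} from hq)]
  exact ENNReal.toReal_ofReal (Real.rpow_nonneg (NNReal.coe_nonneg _) τ)


omit [MeasurableSpace (quasiSplit F E c N).Adelic] [BorelSpace (quasiSplit F E c N).Adelic] in
/-- **LOCAL UNIFORMITY (reverse smear).**  Under Iwasawa, every `g₀ ∈ G(𝔸)` has a neighbourhood `U` and a constant `A ≥ 1` with `H(x g)^τ ≤ A^τ · H(x g₀)^τ` for all `g ∈ U`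
and ALL `x ∈ G(𝔸)` (`τ ≥ 0`) — so any series `Σ_q H(γ̃_q g)^τ` is dominated on `U` by `A^τ Σ_q H(γ̃_q g₀)^τ`: the locally uniform majorant that continuity ∕ holomorphy of
Eisenstein series consume (★ p09's R4a kit). [cite: Garrett2018, §3.10 (proof of Cor. 3.10.2)] [cite: MoeglinWaldspurger1995, II.1.5] -/
theorem exists_nhds_borelHeight_rpow_mul_le [LocallyCompactSpace (quasiSplit F E c N).Adelic]
    (hIw : ∀ g : (quasiSplit F E c N).Adelic, ∃ b ∈ borelAdelic F E c N, ∃ k : (quasiSplit F E c N).Adelic,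
      adelicVal F E c N ((StdForm.antidiagonal N).over E) k ∈ standardMaximalCompactGL N E ∧ g = b * k)
    {τ : ℝ} (hτ : 0 ≤ τ) (g₀ : (quasiSplit F E c N).Adelic) :
    ∃ U ∈ 𝓝 g₀, ∃ A : ℝ≥0, 1 ≤ A ∧ ∀ g ∈ U, ∀ x : (quasiSplit F E c N).Adelic,
      ((borelHeight (x * g) : ℝ)) ^ τ ≤ (A : ℝ) ^ τ * ((borelHeight (x * g₀) : ℝ)) ^ τ := by
  obtain ⟨C, hCc, hC1⟩ := exists_compact_mem_nhds (1 : (quasiSplit F E c N).Adelic)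
  obtain ⟨A, hA1, hA⟩ := exists_smear_borelHeight hIw hCc
  refine ⟨(fun g => g₀⁻¹ * g) ⁻¹' C, (continuous_const_mul g₀⁻¹).continuousAt.preimage_mem_nhds (by rwa [inv_mul_cancel]), A, hA1, fun g hg x => ?_⟩
  have hxg : x * g = x * g₀ * (g₀⁻¹ * g) := by rw [mul_assoc, mul_inv_cancel_left]
  rw [hxg, ← Real.mul_rpow A.coe_nonneg (borelHeight (x * g₀)).coe_nonneg]
  exact Real.rpow_le_rpow (borelHeight _).coe_nonneg (by exact_mod_cast (hA (x * g₀) (g₀⁻¹ * g) hg).1) hτ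

/-- **GODEMENT'S CRITERION WITH THE LOCALLY UNIFORM MAJORANT**: under the hypotheses of `summable_borelHeight_rpow_of_siegelIntegral`, every `g₀` has a neighbourhood `U` and a
SUMMABLE `u : B(F)∖G(F) → ℝ` (namely `A^τ H(γ̃_q g₀)^τ`) with `H(γ̃_q g)^τ ≤ u q` for all `g ∈ U` and all `q`. [cite: Godement1964, §8] [cite: Garrett2018, §3.10 (proof of Cor. 3.10.2)]
[cite: MoeglinWaldspurger1995, II.1.5] -/
theorem exists_nhds_summable_majorant_borelHeight_rpow [T2Space (quasiSplit F E c N).Adelic] [SecondCountableTopology (quasiSplit F E c N).Adelic]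
    [LocallyCompactSpace (quasiSplit F E c N).Adelic] (μ : Measure (quasiSplit F E c N).Adelic) [μ.IsHaarMeasure]
    (hIw : ∀ g : (quasiSplit F E c N).Adelic, ∃ b ∈ borelAdelic F E c N, ∃ k : (quasiSplit F E c N).Adelic,
      adelicVal F E c N ((StdForm.antidiagonal N).over E) k ∈ standardMaximalCompactGL N E ∧ g = b * k)
    (hceil : ∀ g : (quasiSplit F E c N).Adelic, ∃ C₀ : ℝ≥0, ∀ γ : ↥(unitaryGroupOfForm (c : E →+* E) ((StdForm.antidiagonal N).over E)),
      borelHeight ((quasiSplit F E c N).toAdelic γ * g) ≤ C₀)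
    {τ : ℝ} (hτ : 0 ≤ τ)
    (hE4 : ∃ β' : (quasiSplit F E c N).Adelic → ℝ≥0∞, IsCoveringWeight ↥(borelAdelic F E c N ⊓ (quasiSplit F E c N).arithmeticSubgroup) β' ∧
      ∀ C₀ : ℝ≥0, ∫⁻ y, {y | borelHeight y ≤ C₀}.indicator (fun y => ENNReal.ofReal ((borelHeight y : ℝ) ^ τ)) y * β' y ∂μ ≠ ∞)
    (g₀ : (quasiSplit F E c N).Adelic) :
    ∃ U ∈ 𝓝 g₀, ∃ u : Quotient (orbitRel ↥(borelU (c : E →+* E) ((StdForm.antidiagonal N).over E)) ↥(unitaryGroupOfForm (c : E →+* E) ((StdForm.antidiagonal N).over E))) → ℝ,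
      Summable u ∧ ∀ g ∈ U, ∀ q,
        ((borelHeight ((quasiSplit F E c N).toAdelic (Quotient.out q : ↥(unitaryGroupOfForm (c : E →+* E) ((StdForm.antidiagonal N).over E))) * g) : ℝ)) ^ τ ≤ u q := by
  obtain ⟨U, hU, A, -, hA⟩ := exists_nhds_borelHeight_rpow_mul_le hIw hτ g₀
  exact ⟨U, hU, _, (summable_borelHeight_rpow_of_siegelIntegral μ hIw hceil hτ hE4 g₀).mul_left ((A : ℝ) ^ τ), fun g hg q => hA g hg _⟩

end Head

end Summit.HodgeConjecture.HodgeConjecture.Cruxes.H413.K2E1BorelEisensteinGodementU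

end
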